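import Summits.FinalStateConjecture.FinalStateConjecture.Theorems.UniformPhotonSphereChannels.Negative.ConformalChainRule
import Summits.FinalStateConjecture.FinalStateConjecture.Theorems.UniformPhotonSphereChannels.Negative.CommutedField

/-!
# Crux `UniformPhotonSphereChannels` (K1), negative side — the initial slice of the
# horizon-frame solution

Support file of the standing disprover of item stmt-FinalStateConjecture-10045.  For the conformal
composite `u(T, X) = ψ((α(X+T) − α(X−T))/2, (α(X+T) + α(X−T))/2)` of a `C²`/`C³` function `ψ`
with EVEN data `ψ(0, ·) = g`, `ψ_t(0, ·) = 0`, the slice `T = 0` is explicit in terms of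
`G = g ∘ α` (`initial_slice`, `initial_slice_commuted`):

`u(0, X) = G(X)`, `u_T(0, X) = 0`, `u_X(0, X) = G′(X)`, `u_XT(0, X) = 0`, `u_XX(0, X) = G″(X)`,

so the energy `e(0, ·)` and the commuted energy `e₁(0, ·)` of the pinning files are
`G′² + V(α)α′²G²` and `G″² + V(α)α′²G′²` (`initial_energyDensity`, `initial_commutedDensity`) —
in particular they do not depend on the solution, only on the data.  Finally, on the Rindler chart
(`α = log(κ·)/κ` on `[A₀, ∞)`) the horizon-frame energy of the slice is dominated by the
tortoise-line energy of the data: `e^{κ x_l} ∫_{X_l}^{X_r} e(0, ·) ≤ ∫_{x_l}^{x_r} (g′² + V g²)`,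
`X = e^{κx}/κ` (`initial_energy_le`). [folklore]
-/

namespace Summit.FinalStateConjecture.FinalStateConjecture.Theorems

open Set Filter Topology MeasureTheory intervalIntegral

noncomputable section

namespace WaveDefect

open WaveEnergy

variable {ψ : ℝ → ℝ → ℝ} {α V g : ℝ → ℝ} {u W : ℝ × ℝ → ℝ}

/-- The data `g = ψ(0, ·)` of a `Cⁿ` function is `Cⁿ`. -/
theorem contDiff_data {n : WithTop ℕ∞} (hψ : ContDiff ℝ n (Function.uncurry ψ))
    (h0 : ∀ x, ψ 0 x = g x) : ContDiff ℝ n g := by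
  have : g = fun x => Function.uncurry ψ (0, x) := funext fun x => (h0 x).symm
  rw [this]
  exact hψ.comp (contDiff_const.prodMk contDiff_id)

/-- **The initial slice of the conformal composite** (even data): `u(0,X) = g(αX)`,
`u_T(0,X) = 0`, `u_X(0,X) = (g ∘ α)′(X)`. -/
theorem initial_slice (hψ : ContDiff ℝ 2 (Function.uncurry ψ)) (hα : ContDiff ℝ 2 α)
    (h0 : ∀ x, ψ 0 x = g x) (h1 : ∀ x, deriv (fun τ => ψ τ x) 0 = 0)
    (hu : u = fun z : ℝ × ℝ => ψ ((α (z.2 + z.1) - α (z.2 - z.1)) / 2)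
      ((α (z.2 + z.1) + α (z.2 - z.1)) / 2)) (X : ℝ) :
    u (0, X) = g (α X) ∧ fderiv ℝ u (0, X) (1, 0) = 0 ∧
      fderiv ℝ u (0, X) (0, 1) = deriv (fun y => g (α y)) X := by
  have hfun : u = fun z : ℝ × ℝ => Function.uncurry ψ ((α (z.2 + z.1) - α (z.2 - z.1)) / 2,
      (α (z.2 + z.1) + α (z.2 - z.1)) / 2) := by
    subst hu; rfl
  have hg : ContDiff ℝ 2 g := contDiff_data hψ h0
  have hgd : ∀ y, HasDerivAt g (deriv g y) y := fun y =>
    ((hg.differentiable (by norm_num)) y).hasDerivAt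
  have hαd : ∀ y, HasDerivAt α (deriv α y) y := fun y =>
    ((hα.differentiable (by norm_num)) y).hasDerivAt
  have hd := differentiable_of_contDiff_two hψ
  -- `ψ_t(0, ·) = 0` and `ψ_x(0, ·) = g'` in Fréchet form
  have ht0 : ∀ x, fderiv ℝ (Function.uncurry ψ) (0, x) (1, 0) = 0 := by
    intro x
    rw [← (hasDerivAt_slice_fst hd 0 x).deriv]; exact h1 x
  have hx0 : ∀ x, fderiv ℝ (Function.uncurry ψ) (0, x) (0, 1) = deriv g x := by
    intro x
    rw [← (hasDerivAt_slice_snd hd 0 x).deriv]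
    have : (fun y => Function.uncurry ψ (0, y)) = g := funext fun y => h0 y
    rw [this]
  obtain ⟨hT, hXd⟩ := fderiv_conformal (Ψ := Function.uncurry ψ) hψ hα hα 0 X
  simp only [add_zero, sub_zero, sub_self, zero_div, add_self_div_two] at hT hXd
  refine ⟨?_, ?_, ?_⟩
  · subst hu
    simp [h0]
  · rw [hfun, hT]
    have e1 : (deriv α X, (0 : ℝ)) = (deriv α X) • ((1 : ℝ), (0 : ℝ)) := by ext <;> simp
    rw [e1, map_smul, smul_eq_mul, ht0, mul_zero]
  · rw [hfun, hXd]
    have e2 : ((0 : ℝ), deriv α X) = (deriv α X) • ((0 : ℝ), (1 : ℝ)) := by ext <;> simp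
    rw [e2, map_smul, smul_eq_mul, hx0]
    have hc : HasDerivAt (fun y => g (α y)) (deriv g (α X) * deriv α X) X :=
      (hgd (α X)).comp X (hαd X)
    rw [hc.deriv]; ring

/-- **The commuted field on the initial slice**: for `v = u_X`, `v_T(0,X) = 0` and
`v_X(0,X) = (g ∘ α)″(X)`. -/
theorem initial_slice_commuted (hψ : ContDiff ℝ 3 (Function.uncurry ψ)) (hα : ContDiff ℝ 3 α)
    (h0 : ∀ x, ψ 0 x = g x) (h1 : ∀ x, deriv (fun τ => ψ τ x) 0 = 0)
    (hu : u = fun z : ℝ × ℝ => ψ ((α (z.2 + z.1) - α (z.2 - z.1)) / 2)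
      ((α (z.2 + z.1) + α (z.2 - z.1)) / 2)) (X : ℝ) :
    fderiv ℝ (fun w => fderiv ℝ u w (0, 1)) (0, X) (1, 0) = 0 ∧
      fderiv ℝ (fun w => fderiv ℝ u w (0, 1)) (0, X) (0, 1)
        = deriv (deriv (fun y => g (α y))) X := by
  have hψ2 : ContDiff ℝ 2 (Function.uncurry ψ) := hψ.of_le (by norm_num)
  have hα2 : ContDiff ℝ 2 α := hα.of_le (by norm_num)
  have hu3 : ContDiff ℝ 3 u := by
    subst hu; exact contDiff_conformal (Ψ := Function.uncurry ψ) (n := 3) hψ hα hα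
  have hu2 : ContDiff ℝ 2 u := hu3.of_le (by norm_num)
  have hsl := fun Y => initial_slice hψ2 hα2 h0 h1 hu Y
  constructor
  · rw [fderiv_fderiv_apply hu2, fderiv_fderiv_symm hu2,
      ← (hasDerivAt_fderiv_apply_slice_snd hu2 (1, 0) 0 X).deriv]
    have : (fun y => fderiv ℝ u (0, y) (1, 0)) = fun _ => (0 : ℝ) := funext fun y => (hsl y).2.1
    rw [this, deriv_const]
  · rw [fderiv_fderiv_apply hu2, ← (hasDerivAt_fderiv_apply_slice_snd hu2 (0, 1) 0 X).deriv]
    have : (fun y => fderiv ℝ u (0, y) (0, 1)) = deriv (fun y => g (α y)) :=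
      funext fun y => (hsl y).2.2
    rw [this]

/-- The horizon-frame potential on the initial slice: `W(0, X) = V(αX) α′(X)²`. -/
theorem initial_potential
    (hW : W = fun z : ℝ × ℝ => V ((α (z.2 + z.1) + α (z.2 - z.1)) / 2)
      * deriv α (z.2 + z.1) * deriv α (z.2 - z.1)) (X : ℝ) :
    W (0, X) = V (α X) * deriv α X ^ 2 := by
  subst hW
  simp only [add_zero, sub_zero, add_self_div_two]
  ring

/-- **The energy density on the initial slice**: `e(0,X) = G′(X)² + V(αX)α′(X)² G(X)²`,
`G = g ∘ α`. -/
theorem initial_energyDensity (hψ : ContDiff ℝ 2 (Function.uncurry ψ)) (hα : ContDiff ℝ 2 α)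
    (h0 : ∀ x, ψ 0 x = g x) (h1 : ∀ x, deriv (fun τ => ψ τ x) 0 = 0)
    (hu : u = fun z : ℝ × ℝ => ψ ((α (z.2 + z.1) - α (z.2 - z.1)) / 2)
      ((α (z.2 + z.1) + α (z.2 - z.1)) / 2))
    (hW : W = fun z : ℝ × ℝ => V ((α (z.2 + z.1) + α (z.2 - z.1)) / 2)
      * deriv α (z.2 + z.1) * deriv α (z.2 - z.1))
    {e : ℝ × ℝ → ℝ}
    (he : ∀ z, e z = (fderiv ℝ u z (1, 0)) ^ 2 + (fderiv ℝ u z (0, 1)) ^ 2 + W z * u z ^ 2)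
    (X : ℝ) :
    e (0, X) = deriv (fun y => g (α y)) X ^ 2 + V (α X) * deriv α X ^ 2 * g (α X) ^ 2 := by
  obtain ⟨hu0, huT, huX⟩ := initial_slice hψ hα h0 h1 hu X
  rw [he, hu0, huT, huX, initial_potential hW]
  ring

/-- **The commuted energy density on the initial slice**:
`e₁(0,X) = G″(X)² + V(αX)α′(X)² G′(X)²`, `G = g ∘ α`. -/
theorem initial_commutedDensity (hψ : ContDiff ℝ 3 (Function.uncurry ψ)) (hα : ContDiff ℝ 3 α)
    (h0 : ∀ x, ψ 0 x = g x) (h1 : ∀ x, deriv (fun τ => ψ τ x) 0 = 0)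
    (hu : u = fun z : ℝ × ℝ => ψ ((α (z.2 + z.1) - α (z.2 - z.1)) / 2)
      ((α (z.2 + z.1) + α (z.2 - z.1)) / 2))
    (hW : W = fun z : ℝ × ℝ => V ((α (z.2 + z.1) + α (z.2 - z.1)) / 2)
      * deriv α (z.2 + z.1) * deriv α (z.2 - z.1))
    {e₁ : ℝ × ℝ → ℝ}
    (he₁ : ∀ z, e₁ z = (fderiv ℝ (fun w => fderiv ℝ u w (0, 1)) z (1, 0)) ^ 2
      + (fderiv ℝ (fun w => fderiv ℝ u w (0, 1)) z (0, 1)) ^ 2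
      + W z * (fderiv ℝ u z (0, 1)) ^ 2)
    (X : ℝ) :
    e₁ (0, X) = deriv (deriv (fun y => g (α y))) X ^ 2
      + V (α X) * deriv α X ^ 2 * deriv (fun y => g (α y)) X ^ 2 := by
  obtain ⟨hvT, hvX⟩ := initial_slice_commuted hψ hα h0 h1 hu X
  obtain ⟨-, -, huX⟩ := initial_slice (hψ.of_le (by norm_num)) (hα.of_le (by norm_num)) h0 h1 hu X
  rw [he₁, hvT, hvX, huX, initial_potential hW]
  ring

/-- **The horizon-frame energy of the initial slice is dominated by the tortoise-line energy of
the data.**  On the Rindler chart (`α = log(κ·)/κ` on `[A₀, ∞)`, `κ > 0`), with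
`X_l = e^{κ x_l}/κ > A₀` (the sign of `A₀` is irrelevant), `x_l ≤ x_r`, `X_r = e^{κ x_r}/κ`, `V ≥ 0` continuous and `g ∈ C¹`:
`e^{κ x_l} ∫_{X_l}^{X_r} (G′² + V(α)α′²G²) ≤ ∫_{x_l}^{x_r} (g′² + V g²)`, `G = g ∘ α`. [folklore] -/
theorem initial_energy_le {κ A₀ xl xr : ℝ} (hκ : 0 < κ) (hα : ContDiff ℝ 2 α)
    (hαlog : ∀ a, A₀ ≤ a → α a = Real.log (κ * a) / κ)
    (hα' : ∀ a, A₀ < a → deriv α a = 1 / (κ * a))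
    (hxl : A₀ < Real.exp (κ * xl) / κ) (hlr : xl ≤ xr)
    (hVc : Continuous V) (hV0 : ∀ x, 0 ≤ V x) (hg : ContDiff ℝ 1 g) :
    Real.exp (κ * xl) * ∫ X in (Real.exp (κ * xl) / κ)..(Real.exp (κ * xr) / κ),
        (deriv (fun y => g (α y)) X ^ 2 + V (α X) * deriv α X ^ 2 * g (α X) ^ 2)
      ≤ ∫ x in xl..xr, (deriv g x ^ 2 + V x * g x ^ 2) := by
  set Xl : ℝ := Real.exp (κ * xl) / κ with hXl
  set Xr : ℝ := Real.exp (κ * xr) / κ with hXr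
  have hXlr : Xl ≤ Xr := by
    rw [hXl, hXr]
    exact div_le_div_of_nonneg_right (Real.exp_le_exp.mpr
      (mul_le_mul_of_nonneg_left hlr hκ.le)) hκ.le
  have hlogX : ∀ x, Real.log (κ * (Real.exp (κ * x) / κ)) / κ = x := by
    intro x
    rw [mul_div_cancel₀ _ hκ.ne', Real.log_exp, mul_div_cancel_left₀ _ hκ.ne']
  have hαl : α Xl = xl := by rw [hαlog _ hxl.le, hXl, hlogX]
  have hαr : α Xr = xr := by rw [hαlog _ (hxl.le.trans hXlr), hXr, hlogX]
  have hgd : ∀ y, HasDerivAt g (deriv g y) y := fun y =>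
    ((hg.differentiable one_ne_zero) y).hasDerivAt
  have hαd : ∀ y, HasDerivAt α (deriv α y) y := fun y =>
    ((hα.differentiable (by norm_num)) y).hasDerivAt
  have hG' : ∀ X, deriv (fun y => g (α y)) X = deriv g (α X) * deriv α X := fun X =>
    ((hgd (α X)).comp X (hαd X)).deriv
  have hg'c : Continuous (deriv g) := hg.continuous_deriv le_rfl
  have hα'c : Continuous (deriv α) := hα.continuous_deriv (by norm_num)
  -- the substitution `x = α X`
  set f : ℝ → ℝ := fun x => deriv g x ^ 2 + V x * g x ^ 2 with hf
  have hfc : Continuous f := by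
    simp only [hf]
    exact (hg'c.pow 2).add (hVc.mul (hg.continuous.pow 2))
  have hsubst : ∫ x in xl..xr, f x = ∫ X in Xl..Xr, f (α X) * deriv α X := by
    have h := intervalIntegral.integral_comp_mul_deriv' (a := Xl) (b := Xr) (f := α)
      (f' := deriv α) (g := f) (fun X _ => hαd X) hα'c.continuousOn hfc.continuousOn
    rw [hαl, hαr] at h
    exact h.symm
  rw [hsubst, ← intervalIntegral.integral_const_mul]
  -- pointwise comparison on `[Xl, Xr]`
  have hsub : uIcc Xl Xr ⊆ Icc Xl Xr := (uIcc_of_le hXlr).subset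
  have hc1 : Continuous fun X => Real.exp (κ * xl) *
      (deriv (fun y => g (α y)) X ^ 2 + V (α X) * deriv α X ^ 2 * g (α X) ^ 2) := by
    have h1 : Continuous fun X => deriv (fun y => g (α y)) X := by
      have : (fun X => deriv (fun y => g (α y)) X) = fun X => deriv g (α X) * deriv α X :=
        funext hG'
      rw [this]; exact (hg'c.comp hα.continuous).mul hα'c
    exact continuous_const.mul ((h1.pow 2).add (((hVc.comp hα.continuous).mul
      (hα'c.pow 2)).mul ((hg.continuous.comp hα.continuous).pow 2)))
  have hc2 : Continuous fun X => f (α X) * deriv α X := (hfc.comp hα.continuous).mul hα'c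
  refine intervalIntegral.integral_mono_on hXlr (hc1.intervalIntegrable _ _)
    (hc2.intervalIntegrable _ _) fun X hX => ?_
  have hXpos : 0 < X := by
    have : 0 < Xl := by rw [hXl]; exact div_pos (Real.exp_pos _) hκ
    exact this.trans_le hX.1
  have hXA : A₀ < X := hxl.trans_le hX.1
  have hα'X : deriv α X = 1 / (κ * X) := hα' X hXA
  have hα'pos : 0 < deriv α X := by rw [hα'X]; positivity
  -- `e^{κ x_l} α'(X) ≤ 1` on `[Xl, ∞)`
  have hkey : Real.exp (κ * xl) * deriv α X ≤ 1 := by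
    rw [hα'X, mul_one_div, div_le_one (by positivity)]
    have : Real.exp (κ * xl) = κ * Xl := by rw [hXl, mul_div_cancel₀ _ hκ.ne']
    rw [this]
    exact mul_le_mul_of_nonneg_left hX.1 hκ.le
  rw [hG']
  simp only [hf]
  have hnn : 0 ≤ deriv α X * (deriv g (α X) ^ 2 + V (α X) * g (α X) ^ 2) :=
    mul_nonneg hα'pos.le (add_nonneg (sq_nonneg _) (mul_nonneg (hV0 _) (sq_nonneg _)))
  have hid : Real.exp (κ * xl) * ((deriv g (α X) * deriv α X) ^ 2
      + V (α X) * deriv α X ^ 2 * g (α X) ^ 2)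
      = (Real.exp (κ * xl) * deriv α X) * (deriv α X * (deriv g (α X) ^ 2
        + V (α X) * g (α X) ^ 2)) := by ring
  rw [hid]
  calc (Real.exp (κ * xl) * deriv α X) * (deriv α X * (deriv g (α X) ^ 2 + V (α X) * g (α X) ^ 2))
      ≤ 1 * (deriv α X * (deriv g (α X) ^ 2 + V (α X) * g (α X) ^ 2)) :=
        mul_le_mul_of_nonneg_right hkey hnn
    _ = (deriv g (α X) ^ 2 + V (α X) * g (α X) ^ 2) * deriv α X := by ring

end WaveDefect

end

end Summit.FinalStateConjecture.FinalStateConjecture.Theorems
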